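import Mathlib

/-!
# STUB-IDEAS `stub_heegnerIndexLowerAtTwo` — k = 2, gen 44 (planner, technique: literature transfer /
recent-theorem–open-question harvest; typed dictionary)

Companion sketch of `Ideas/stub_heegnerIndexLowerAtTwo-k2.md` (card slug
`stub-heegnerindexloweratwo-k2-g44`).  **BSD is NOT proved by any of this; the crux
`SplitBadTwoLowerHalfOfFacts` and the stub `stub_heegnerIndexLowerAtTwo` are NOT proved here.**

What is typed here (all `decide`d, no `sorry`):

* §A the dyadic-key ↦ twist-class dictionary `u(key) ∈ {−1, 2, −2}` (W = E_D^{(u)}, `D ≡ 1 (mod 4)`,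
  E_D good ordinary at 2) and the root-number sign `χ_u(−1)` relating `w(W) = χ_u(−N(E_D))·w(E_D)
  = χ_u(−1)·w(E_D)` (`N(E_D) = 49·D²` is an odd square up to 49, so `χ_u(N(E_D)) = 1`):
  the partner `E_D` has the SAME parity as `W` exactly on the keys (0,1),(0,5) (`u = 2`).
* §B LTYZ 2025's printed abelian-base proviso (i) (p. 3 L12–17: "∃ a quadratic `F/F₀` unramified
  above 2 with `E/F` good everywhere"), read dyadically for `F₀ = K₀(√u)`, `F = F₀(E_D[𝔭²])`,
  `ℚ₂(E_D[𝔭²]) = ℚ₂(√δ)`, `δ ∈ {−1, 3}` (the two conductor-4 quadratic extensions of `ℚ₂`):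
  `ℚ₂(√u,√δ)/ℚ₂(√u)` is unramified iff `δ` or `uδ` has unramified square class (`≡ 1, 5 mod 8`),
  which happens iff `u = −1`.  (The harvest's located gap: LTYZ's forthcoming [34] needs `2`
  UNRAMIFIED in `F₀/K₀` (p. 63 L1), and `K₀(√u)/K₀` is ramified above 2 for every `u` — so the
  printed roadmap does not reach `W` even on the `u = −1` keys; see the card, Plan 1.)
-/

namespace Summit.BirchSwinnertonDyer.BirchSwinnertonDyer.Cruxes.SplitBadTwoLowerHalfOfFacts.HarvestK2G44

/-! ## §A  key ↦ twist class, and the partner-parity sign -/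

/-- The six dyadic keys `(d % 2, [d]₈)` of the stub's class (STUB-PLAN v7.8). -/
def dyadicKeys : List (ℕ × ℕ) := [(1, 7), (1, 3), (0, 1), (0, 7), (0, 3), (0, 5)]

/-- Twist class `u(key)`: `W = E_D^{(u)}` with `D ≡ 1 (mod 4)`; keys (1,3),(1,7) ↦ −1,
(0,1),(0,5) ↦ 2, (0,3),(0,7) ↦ −2 (d = u·D with D ≡ 1 mod 4 and d squarefree). -/
def twistClass : ℕ × ℕ → ℤ
  | (1, 3) => -1
  | (1, 7) => -1
  | (0, 1) => 2
  | (0, 5) => 2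
  | (0, 3) => -2
  | (0, 7) => -2
  | _ => 0

/-- `χ_u(−1)` for the three twist classes, by Mathlib's quadratic characters `χ₄` (u = −1),
`χ₈` (u = 2), `χ₈'` (u = −2). -/
def signAtMinusOne : ℤ → ℤ
  | -1 => ZMod.χ₄ (-1 : ℤ)
  | 2 => ZMod.χ₈ (-1 : ℤ)
  | -2 => ZMod.χ₈' (-1 : ℤ)
  | _ => 0

theorem chi4_neg_one : ZMod.χ₄ ((-1 : ℤ) : ZMod 4) = -1 := by
  rw [ZMod.χ₄_int_eq_if_mod_four]; decide

theorem chi8_neg_one : ZMod.χ₈ ((-1 : ℤ) : ZMod 8) = 1 := by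
  rw [ZMod.χ₈_int_eq_if_mod_eight]; decide

theorem chi8'_neg_one : ZMod.χ₈' ((-1 : ℤ) : ZMod 8) = -1 := by
  rw [ZMod.χ₈'_int_eq_if_mod_eight]; decide

/-- Partner parity: `w(W) = χ_u(−1)·w(E_D)`; the sign is `+1` exactly for `u = 2`. -/
theorem signAtMinusOne_values :
    signAtMinusOne (-1) = -1 ∧ signAtMinusOne 2 = 1 ∧ signAtMinusOne (-2) = -1 := by
  refine ⟨?_, ?_, ?_⟩
  · show ZMod.χ₄ ((-1 : ℤ) : ZMod 4) = -1; exact chi4_neg_one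
  · show ZMod.χ₈ ((-1 : ℤ) : ZMod 8) = 1; exact chi8_neg_one
  · show ZMod.χ₈' ((-1 : ℤ) : ZMod 8) = -1; exact chi8'_neg_one

/-- The keys on which the good-ordinary partner `E_D` has the SAME analytic parity as `W`
(so, for `r_an(W) = 1`, `r_an(E_D)` is odd and LTYZ 2025 Thm 1.1 (ii) prints BSD₂(E_D) when
`r_an(E_D) = 1`): exactly the `u = 2` keys. -/
theorem sameParityKeys :
    (dyadicKeys.filter fun k => twistClass k = 2) = [(0, 1), (0, 5)] := by decide

/-! ## §B  LTYZ proviso (i), dyadically -/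

/-- Unramified square class at 2 for an integer met here: odd and `≡ 1 (mod 4)`
(i.e. `≡ 1` or `5 (mod 8)`: `ℚ₂(√n) ∈ {ℚ₂, ℚ₂(√5)}`). Even `n` with `2 ∥ n` is ramified. -/
def IsUnramifiedDyadicSquareclass (n : ℤ) : Prop := n % 2 ≠ 0 ∧ n % 4 = 1

instance (n : ℤ) : Decidable (IsUnramifiedDyadicSquareclass n) := by
  unfold IsUnramifiedDyadicSquareclass; infer_instance

/-- The two candidates for `ℚ₂(E_D[𝔭²]) = ℚ₂(√δ)`: the conductor-4 quadratic extensions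
`ℚ₂(√−1)`, `ℚ₂(√3)` of `ℚ₂` (which one occurs depends on `ψ_D(𝔭)/2 mod 4`). -/
def deltaCandidates : List ℤ := [-1, 3]

/-- The three twist classes. -/
def twistCandidates : List ℤ := [-1, 2, -2]

/-- LTYZ proviso (i) read locally above `𝔭`: `ℚ₂(√u,√δ)/ℚ₂(√u)` is unramified iff `δ` or `u·δ`
lies in an unramified square class (a biquadratic extension of `ℚ₂` with `e = 2` contains `√5`). -/
def ProvisoOneLocal (u δ : ℤ) : Prop :=
  IsUnramifiedDyadicSquareclass δ ∨ IsUnramifiedDyadicSquareclass (u * δ)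

instance (u δ : ℤ) : Decidable (ProvisoOneLocal u δ) := by
  unfold ProvisoOneLocal; infer_instance

/-- **Typed dictionary lemma (decided).** For every twist class `u` and either candidate `δ`,
proviso (i) holds above `𝔭` iff `u = −1` (keys (1,3),(1,7)). Above `𝔭̄` it always holds
(`K₀(E_D[𝔭²])/K₀` is unramified at `𝔭̄` by Néron–Ogg–Shafarevich) — not typed. -/
theorem provisoOne_iff_u_eq_neg_one :
    ∀ u ∈ twistCandidates, ∀ δ ∈ deltaCandidates, (ProvisoOneLocal u δ ↔ u = -1) := by
  decide

/-- The located gap, as data: `K₀(√u)/K₀` is ramified above 2 for every twist class (`u ∈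
{−1, ±2}` has ramified square class), so a theorem whose binder is "2 unramified in F₀/K₀"
(LTYZ [34], p. 63 L1) never applies to `F₀ = K₀(√u)`. -/
theorem twistField_ramified_at_two :
    ∀ u ∈ twistCandidates, ¬ IsUnramifiedDyadicSquareclass u := by decide

end Summit.BirchSwinnertonDyer.BirchSwinnertonDyer.Cruxes.SplitBadTwoLowerHalfOfFacts.HarvestK2G44
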